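import Literature.Geometry.Riemannian.ThreeShrinkerDegenerateLeafJacobi
import HarnessLib

/-!
# Degenerate three-dimensional shrinkers have `S ≡ 1` (the leaves are round of curvature `½`)

Conclusion of the analysis of `ThreeShrinkerDegenerateLeaves`, `…LeafFrame`, `…LeafJacobi`
(degenerate case of Munteanu–Wang 2016, Thm. 1.2: a complete connected normalised
three-dimensional gradient shrinking Ricci soliton with `Ric ≥ 0`, `S > 0` and a null vector of
`Ric` somewhere). We prove **`S ≡ 1` and `f = 1 + h`**, `h = |∇f|² − (2/S)Ric(∇f,∇f)`
(`scalarCurvature_eq_one`), i.e. the leaves of the null foliation are round spheres of Gauss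
curvature `½` and the potential is the cylinder potential — the intrinsic form of "the universal
cover is the round cylinder `S² × ℝ`" used for the weighted-volume computation of
`threeShrinkerClassification_modelData`.

The argument (Hamilton 1988, §10, "a compact two-dimensional shrinker with positive curvature is
round", transplanted to the leaves and carried out inside `M`): `S` attains its extrema over `M`
at critical points `p ∈ Σ₀ = {h = 0}` of `f` (`ThreeShrinkerDegenerateLeaves`); if
`a = ½ − S(p)/2 ≠ 0`, the profiles `y = f ∘ γ` along all unit leaf geodesics `γ_{w(s)}`,
`w(s) = cos s e + sin s n₀`, from `p` coincide (autonomous ODE with the same data) and reach a first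
critical time `τ > 0` with `y''(τ) = b` of sign opposite to `a`; the Jacobi field of the family is
`(y'/a) n` (`…LeafJacobi`), so it vanishes at `τ`: the endpoint `γ_{w(s)}(τ) = q` is independent of
`s`, while the arrival direction `Θ(s) = γ̇_{w(s)}(τ) ∈ T_qM` moves with speed
`|D_s Θ| = |D_t J(τ)| = |b/a|` (symmetry lemma) on the unit circle of the leaf plane at `q`,
injectively modulo `2π`; a closed curve on the unit circle with constant speed and winding `±1`
has speed `1` (`ShrinkerLeafProfile.rotation_number_eq_one`), so `|b| = |a|`, i.e.
`S(p) + S(q) = 2` with `f = S = C e^{f}` at both critical points and `f(p) ≠ f(q)` — impossible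
(`ShrinkerLeafProfile.eq_of_eq_mul_exp_of_add_eq_two`). Hence `S = 1` at the minimum and the
maximum of `S`.

Everything is proved; no definitions are introduced.

## References

* O. Munteanu, J. Wang, arXiv:1606.01861, Thm. 1.2 (p. 3). [MunteanuWang2016]
* R. S. Hamilton, *The Ricci flow on surfaces*, Contemp. Math. 71 (1988), §10. [Hamilton1988]
* B. O'Neill, *Semi-Riemannian geometry*, 1983, Ch. 4, Prop. 4.44; Ch. 8, Lemma 8.3. [ONeill1983]
-/

noncomputable section

set_option maxSynthPendingDepth 3

open Bundle Set Function Filter Module Metric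
open scoped Manifold ContDiff Topology NNReal

namespace Literature.Geometry.Riemannian

open Lorentzian Lorentzian.PseudoRiemannianMetric
open Literature.Analysis.ODE.ShrinkerLeafProfile

variable {M : Type*} [TopologicalSpace M] [ChartedSpace (EuclideanSpace ℝ (Fin 3)) M]
  [IsManifold (𝓡 3) ∞ M]
  (g : PseudoRiemannianMetric (𝓡 3) ∞ (EuclideanSpace ℝ (Fin 3)) (TangentSpace (𝓡 3) : M → Type _))
  [g.HasLeviCivita]

namespace DegenerateShrinker

/-! ### Curves: a chain rule for velocities, and curves with zero velocity are constant -/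

omit [IsManifold (𝓡 3) ∞ M] [g.HasLeviCivita] in
/-- `(F ∘ c)'(s) = dF_{c s}(c'(s))` for `F : ℝ³ → M` and a curve `c` in `ℝ³`. [folklore] -/
theorem velocity_comp_of_hasDerivAt {F : EuclideanSpace ℝ (Fin 3) → M}
    {c : ℝ → EuclideanSpace ℝ (Fin 3)} {c' x : EuclideanSpace ℝ (Fin 3)} {s : ℝ}
    (hF : MDifferentiableAt 𝓘(ℝ, EuclideanSpace ℝ (Fin 3)) (𝓡 3) F (c s)) (hc : HasDerivAt c c' s)
    (hx : c s = x) :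
    velocity (𝓡 3) (F ∘ c) s = mfderiv 𝓘(ℝ, EuclideanSpace ℝ (Fin 3)) (𝓡 3) F x c' := by
  subst hx
  have hcm : HasMFDerivAt 𝓘(ℝ, ℝ) 𝓘(ℝ, EuclideanSpace ℝ (Fin 3)) c s
      ((1 : ℝ →L[ℝ] ℝ).smulRight c') :=
    hasMFDerivAt_iff_hasFDerivAt.2 hc.hasFDerivAt
  have hcomp := hF.hasMFDerivAt.comp s hcm
  simp only [velocity]
  rw [hcomp.mfderiv]
  exact congrArg (mfderiv 𝓘(ℝ, EuclideanSpace ℝ (Fin 3)) (𝓡 3) F (c s)) (one_smul ℝ c')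

omit [g.HasLeviCivita] in
/-- **A differentiable curve with identically zero velocity is constant** (read in charts:
`(φ ∘ c)' = dφ(0) = 0` locally, so `c` is locally constant on the connected line). [folklore] -/
theorem eq_of_velocity_eq_zero {c : ℝ → M} (hd : ∀ s, MDifferentiableAt 𝓘(ℝ, ℝ) (𝓡 3) c s)
    (h0 : ∀ s, velocity (𝓡 3) c s = 0) (s s' : ℝ) : c s = c s' := by
  have hloc : IsLocallyConstant c := by
    refine (IsLocallyConstant.iff_eventually_eq c).2 fun s₀ ↦ ?_
    set x₁ := c s₀ with hx₁
    have hsrc : ∀ᶠ s in 𝓝 s₀, c s ∈ (extChartAt (𝓡 3) x₁).source :=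
      (hd s₀).continuousAt.preimage_mem_nhds
        ((isOpen_extChartAt_source x₁).mem_nhds (mem_extChartAt_source x₁))
    obtain ⟨ε, hε, hball⟩ := Metric.eventually_nhds_iff_ball.mp hsrc
    have hderiv : ∀ s ∈ ball s₀ ε, HasDerivAt (extChartAt (𝓡 3) x₁ ∘ c) 0 s := by
      intro s hs
      have hs' : c s ∈ (chartAt (EuclideanSpace ℝ (Fin 3)) x₁).source := by
        rw [← extChartAt_source (𝓡 3)]; exact hball s hs
      have h := hasDerivAt_extChartAt_comp (I := 𝓡 3) (hd s) hs'
      rwa [trivializationAt_snd_eq_mfderiv x₁ (hball s hs), h0 s, map_zero] at h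
    have hconst : ∀ s ∈ ball s₀ ε, (extChartAt (𝓡 3) x₁ ∘ c) s = (extChartAt (𝓡 3) x₁ ∘ c) s₀ :=
      fun s hs ↦ isOpen_ball.is_const_of_deriv_eq_zero (convex_ball s₀ ε).isPreconnected
        (fun s hs ↦ (hderiv s hs).differentiableAt.differentiableWithinAt)
        (fun s hs ↦ (hderiv s hs).deriv) hs (mem_ball_self hε)
    filter_upwards [ball_mem_nhds s₀ hε] with s hs
    have h1 := hconst s hs
    simp only [Function.comp_apply] at h1
    rw [← (extChartAt (𝓡 3) x₁).left_inv (hball s hs), h1,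
      (extChartAt (𝓡 3) x₁).left_inv (hball s₀ (mem_ball_self hε))]
  exact hloc.apply_eq_of_preconnectedSpace s s'

/-! ### The rotation family in the leaf plane -/

omit [g.HasLeviCivita] in
/-- Orthonormality relations of `w = cos s e + sin s n`, `w' = −sin s e + cos s n` for an
orthonormal pair `(e, n)` orthogonal to `ν`. [folklore] -/
theorem rotation_orthonormal {p : M} {e n ν : TangentSpace (𝓡 3) p} (hee : g.val p e e = 1)
    (hnn : g.val p n n = 1) (hen : g.val p e n = 0) (heν : g.val p e ν = 0)
    (hnν : g.val p n ν = 0) (s : ℝ) :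
    g.val p (Real.cos s • e + Real.sin s • n) (Real.cos s • e + Real.sin s • n) = 1 ∧
    g.val p (-Real.sin s • e + Real.cos s • n) (-Real.sin s • e + Real.cos s • n) = 1 ∧
    g.val p (Real.cos s • e + Real.sin s • n) (-Real.sin s • e + Real.cos s • n) = 0 ∧
    g.val p (Real.cos s • e + Real.sin s • n) ν = 0 ∧
    g.val p (-Real.sin s • e + Real.cos s • n) ν = 0 := by
  have hne : g.val p n e = 0 := by rw [g.symm p]; exact hen
  have hcs := Real.cos_sq_add_sin_sq s
  simp only [map_add, map_smul, _root_.add_apply, FunLike.coe_smul, Pi.smul_apply,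
    smul_eq_mul, hee, hnn, hen, hne, heν, hnν, mul_zero, mul_one, add_zero, zero_add]
  refine ⟨?_, ?_, ?_, trivial, trivial⟩ <;> nlinarith [hcs]

section Along

variable [T2Space M] [ConnectedSpace M]
  -- `hg : g.IsRiemannian`, unfolded (positive definiteness on every tangent space)
  (hg : ∀ (x : M) (v : TangentSpace (𝓡 3) x), v ≠ 0 → 0 < g.val x v v)
  {f : M → ℝ} (hf : ContMDiff (𝓡 3) 𝓘(ℝ, ℝ) ∞ f) {lam : ℝ}
  (hsol : ∀ (x : M) (X Y : TangentSpace (𝓡 3) x),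
    g.ricci x X Y + g.hessian f x X Y = lam * g.val x X Y)
  (hRic0 : ∀ (x : M) (w : TangentSpace (𝓡 3) x), 0 ≤ g.ricci x w w)
  (hS : ∀ x, 0 < g.scalarCurvature x) {p₀ : M} {w₀ : TangentSpace (𝓡 3) p₀} (hw₀ : w₀ ≠ 0)
  (hnull : g.ricci p₀ w₀ w₀ = 0)
  {gradf : (x : M) → TangentSpace (𝓡 3) x}
  (hgradf : ∀ x, gradf x = g.sharp x (mvfderiv (𝓡 3) f x : TangentSpace (𝓡 3) x →ₗ[ℝ] ℝ))
  {H : M → ℝ}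
  (hH : ∀ x, H x = g.gradSq f x - 2 / g.scalarCurvature x * g.ricci x (gradf x) (gradf x))
  {κ : (x : M) → TangentSpace (𝓡 3) x → ℝ}
  (hκ : ∀ (x : M) (w : TangentSpace (𝓡 3) x),
    κ x w = g.val x w w - 2 / g.scalarCurvature x * g.ricci x w w)
  {σ : (x : M) → TangentSpace (𝓡 3) x → ℝ}
  (hσ : ∀ (x : M) (w : TangentSpace (𝓡 3) x),
    σ x w = mvfderiv (𝓡 3) f x w - 2 / g.scalarCurvature x * g.ricci x (gradf x) w)
include hg hf hsol hRic0 hS hw₀ hnull hgradf hH hκ hσ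

/-! ### `S = 1` at the critical points of `f` on `Σ₀` -/

set_option maxHeartbeats 1600000 in
/-- **At a critical point `p ∈ Σ₀` of `f` with `f(p) = S(p)`, on a complete normalised degenerate
shrinker, `S(p) = 1`.** (See the module docstring for the argument.)
[cite: MunteanuWang2016, Thm. 1.2] [cite: Hamilton1988, §10] -/
theorem scalarCurvature_eq_one_of_critical (hlam : lam = 1 / 2)
    (hc : IsGeodesicallyComplete g.leviCivita) {C : ℝ}
    (hSC : ∀ x, g.scalarCurvature x = C * Real.exp (f x - H x)) {p : M} (hp : H p = 0)
    (hdf : mvfderiv (𝓡 3) f p = 0) (hfS : f p = g.scalarCurvature p) :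
    g.scalarCurvature p = 1 := by
  haveI := contMDiffCovariantDerivative_leviCivita_one g
  haveI := contMDiffCovariantDerivative_leviCivita_infty g le_rfl
  have hLC := PseudoRiemannianMetric.isLeviCivita_leviCivita_holds (g := g)
  have hsymm := g.symm p
  have hCpos : 0 < C := by
    have h := hSC p
    have hSp := hS p
    by_contra hC
    push Not at hC
    have : C * Real.exp (f p - H p) ≤ 0 := mul_nonpos_of_nonpos_of_nonneg hC (Real.exp_pos _).le
    linarith
  -- an orthonormal frame `(e, n₀, ν₀)` at `p` with `ν₀` null
  obtain ⟨ν₀, hνν, hν0⟩ := exists_unit_null g hg hf hsol hRic0 hS hw₀ hnull p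
  have hν : g.ricci p ν₀ ν₀ = 0 := (hν0 ν₀).1
  obtain ⟨k, fr, hfrnone, hfron, hcard⟩ := exists_orthonormal_frame_with_head g hg p hνν
  have hk : k = 2 := by
    simp only [Fintype.card_option, Fintype.card_fin, finrank_euclideanSpace_fin] at hcard
    omega
  subst hk
  set e : TangentSpace (𝓡 3) p := fr (some 0) with he_def
  set n₀ : TangentSpace (𝓡 3) p := fr (some 1) with hn_def
  have hee : g.val p e e = 1 := by have := hfron (some 0) (some 0); simpa using this
  have hnn : g.val p n₀ n₀ = 1 := by have := hfron (some 1) (some 1); simpa using this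
  have hen : g.val p e n₀ = 0 := by have := hfron (some 0) (some 1); simpa using this
  have heν : g.val p e ν₀ = 0 := by
    have := hfron (some 0) none; rw [hfrnone] at this; simpa using this
  have hnν : g.val p n₀ ν₀ = 0 := by
    have := hfron (some 1) none; rw [hfrnone] at this; simpa using this
  -- suppose `a ≠ 0`
  by_contra hS1
  set a : ℝ := 1 / 2 - g.scalarCurvature p / 2 with ha
  have ha0 : a ≠ 0 := by
    intro h; apply hS1; rw [ha] at h; linarith
  -- the rotation family and the geodesic family
  set w : ℝ → TangentSpace (𝓡 3) p := fun s ↦ Real.cos s • e + Real.sin s • n₀ with hw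
  set w' : ℝ → TangentSpace (𝓡 3) p := fun s ↦ -Real.sin s • e + Real.cos s • n₀ with hw'
  have hwd : ∀ s, HasDerivAt (fun s ↦ w s : ℝ → EuclideanSpace ℝ (Fin 3)) (w' s) s := fun s ↦ by
    have h1 := (Real.hasDerivAt_cos s).smul_const (id e : EuclideanSpace ℝ (Fin 3))
    have h2 := (Real.hasDerivAt_sin s).smul_const (id n₀ : EuclideanSpace ℝ (Fin 3))
    exact h1.add h2
  have hws : ContMDiff 𝓘(ℝ, ℝ) 𝓘(ℝ, EuclideanSpace ℝ (Fin 3)) ∞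
      (fun s ↦ (id (w s) : EuclideanSpace ℝ (Fin 3))) :=
    ((Real.contDiff_cos.smul (contDiff_const (c := (id e : EuclideanSpace ℝ (Fin 3))))).add
      (Real.contDiff_sin.smul (contDiff_const (c := (id n₀ : EuclideanSpace ℝ (Fin 3)))))).contMDiff
  have hrot : ∀ s, g.val p (w s) (w s) = 1 ∧ g.val p (w' s) (w' s) = 1 ∧ g.val p (w s) (w' s) = 0 ∧
      g.val p (w s) ν₀ = 0 ∧ g.val p (w' s) ν₀ = 0 := fun s ↦
    rotation_orthonormal g hee hnn hen heν hnν s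
  set X : ℝ → ℝ → M := fun t s ↦ maximalGeodesic g.leviCivita p (w s) t with hX
  have hXs : ContMDiff (𝓘(ℝ, ℝ).prod 𝓘(ℝ, ℝ)) (𝓡 3) ∞ (uncurry X) := by
    have hφ : ContMDiff (𝓘(ℝ, ℝ).prod 𝓘(ℝ, ℝ)) (𝓘(ℝ, ℝ).prod 𝓘(ℝ, EuclideanSpace ℝ (Fin 3))) ∞
        (fun q : ℝ × ℝ ↦ ((q.1, w q.2) : ℝ × EuclideanSpace ℝ (Fin 3))) :=
      contMDiff_fst.prodMk (hws.comp contMDiff_snd)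
    exact (contMDiff_maximalGeodesic_family hc p).comp hφ
  have hgeoS := fun s ↦ maximalGeodesic_of_isGeodesicallyComplete hc p (w s)
  have hX0 : ∀ s, X 0 s = p := fun s ↦ (hgeoS s).2.2.1
  have hXv : ∀ s, velocity (𝓡 3) (fun t ↦ X t s) 0 = w s := fun s ↦ (hgeoS s).2.2.2
  have hXgeo : ∀ s, IsGeodesicOn g.leviCivita (fun t ↦ X t s) univ := fun s ↦ (hgeoS s).2.1
  -- `γ_v(t) = exp_p(t v)`
  have hexp : ∀ (v : TangentSpace (𝓡 3) p) (t : ℝ), maximalGeodesic g.leviCivita p v t =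
      expMap g.leviCivita p (t • v) := fun v t ↦ by
    rw [expMap_eq_maximalGeodesic hc, maximalGeodesic_smul hc, mul_one]
  have hexps : ContMDiff 𝓘(ℝ, EuclideanSpace ℝ (Fin 3)) (𝓡 3) ∞
      (fun u : EuclideanSpace ℝ (Fin 3) ↦
        expMap g.leviCivita p (show TangentSpace (𝓡 3) p from u)) :=
    contMDiff_riemannianExpMap g le_rfl hc p
  -- the `s`-velocity of the family is the Jacobi field of the linear variation
  have hJeq : ∀ t s, velocity (𝓡 3) (X t) s =
      velocity (𝓡 3) (fun s' : ℝ ↦ maximalGeodesic g.leviCivita p (w s + s' • w' s) t) 0 := by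
    intro t s
    -- `F_t u = γ_u(t) = exp_p(t u)` is differentiable in `u`
    have hF : (fun u : EuclideanSpace ℝ (Fin 3) ↦ maximalGeodesic g.leviCivita p u t) =
        (fun u : EuclideanSpace ℝ (Fin 3) ↦
          expMap g.leviCivita p (show TangentSpace (𝓡 3) p from u)) ∘
          fun u : EuclideanSpace ℝ (Fin 3) ↦ t • u :=
      funext fun u ↦ hexp u t
    have hFt : ∀ u, MDifferentiableAt 𝓘(ℝ, EuclideanSpace ℝ (Fin 3)) (𝓡 3)
        (fun u : EuclideanSpace ℝ (Fin 3) ↦ maximalGeodesic g.leviCivita p u t) u := fun u ↦ by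
      rw [hF]
      exact (hexps.comp (contDiff_const_smul t).contMDiff).mdifferentiableAt (by simp)
    have h1 : velocity (𝓡 3) (X t) s = mfderiv 𝓘(ℝ, EuclideanSpace ℝ (Fin 3)) (𝓡 3)
        (fun u : EuclideanSpace ℝ (Fin 3) ↦ maximalGeodesic g.leviCivita p u t) (w s) (w' s) :=
      velocity_comp_of_hasDerivAt (F := fun u ↦ maximalGeodesic g.leviCivita p u t)
        (c := fun s ↦ w s) (hFt _) (hwd s) rfl
    have hline : HasDerivAt (fun s' : ℝ ↦ w s + s' • w' s : ℝ → EuclideanSpace ℝ (Fin 3)) (w' s)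
        0 := by
      have h := ((hasDerivAt_id (0 : ℝ)).smul_const
        (id (w' s) : EuclideanSpace ℝ (Fin 3))).const_add (id (w s) : EuclideanSpace ℝ (Fin 3))
      exact h.congr_deriv (one_smul _ _)
    have h2 : velocity (𝓡 3) (fun s' : ℝ ↦ maximalGeodesic g.leviCivita p (w s + s' • w' s) t) 0 =
        mfderiv 𝓘(ℝ, EuclideanSpace ℝ (Fin 3)) (𝓡 3)
          (fun u : EuclideanSpace ℝ (Fin 3) ↦ maximalGeodesic g.leviCivita p u t) (w s) (w' s) :=
      velocity_comp_of_hasDerivAt (F := fun u ↦ maximalGeodesic g.leviCivita p u t)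
        (c := fun s' : ℝ ↦ w s + s' • w' s) (hFt _) hline (by rw [zero_smul, add_zero])
    rw [h1, h2]
  -- the profiles coincide: `f ∘ γ_{w s} = f ∘ γ_{w 0}`
  have hκw : ∀ s, κ p (w s) = 0 := fun s ↦ by
    rw [kappa_eq_sq_of_unit_null g hg hf hsol hRic0 hS hw₀ hnull hκ hνν hν (w s), hsymm,
      (hrot s).2.2.2.1]
    ring
  have hprof := fun s ↦ profile_hasDerivAt g hg hf hsol hRic0 hS hw₀ hnull hgradf hH hκ hσ hlam hc
    hSC hp hdf (hrot s).1 (hκw s)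
  set Y : ℝ → ℝ := fun t ↦ f (X t 0) with hY
  set Y₁ : ℝ → ℝ := fun t ↦ mvfderiv (𝓡 3) f (X t 0) (velocity (𝓡 3) (fun t ↦ X t 0) t) with hY₁
  have hYd : ∀ t, HasDerivAt Y (Y₁ t) t := (hprof 0).1
  have hY₁d : ∀ t, HasDerivAt Y₁ (1 / 2 - C / 2 * Real.exp (Y t)) t := (hprof 0).2.1
  have hY₁0 : Y₁ 0 = 0 := (hprof 0).2.2.1
  have haY : 1 / 2 - C / 2 * Real.exp (Y 0) = a := (hprof 0).2.2.2
  have hΦ : ContDiff ℝ 1 fun y : ℝ ↦ 1 / 2 - C / 2 * Real.exp y :=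
    contDiff_const.sub (contDiff_const.mul Real.contDiff_exp)
  have hYs : ∀ s t, f (X t s) = Y t := fun s t ↦
    eq_of_hasDerivAt_two_autonomous hΦ (hprof s).1 (hprof s).2.1 hYd hY₁d
      (by show f (X 0 s) = Y 0; simp only [hY]; rw [hX0 s, hX0 0])
      (by rw [(hprof s).2.2.1, hY₁0]) t
  have hY₁s : ∀ s t, mvfderiv (𝓡 3) f (X t s) (velocity (𝓡 3) (fun t ↦ X t s) t) = Y₁ t := by
    intro s t
    have h1 : HasDerivAt (fun t ↦ f (X t s)) (mvfderiv (𝓡 3) f (X t s)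
        (velocity (𝓡 3) (fun t ↦ X t s) t)) t := (hprof s).1 t
    have h2 : HasDerivAt (fun t ↦ f (X t s)) (Y₁ t) t := by
      have : (fun t ↦ f (X t s)) = Y := funext (hYs s)
      rw [this]; exact hYd t
    exact h1.unique h2
  -- energy identity and the first critical time `τ`
  have hnormY : ∀ t, Y₁ t ^ 2 = Y t - C * Real.exp (Y t) := fun t ↦
    profile_energy g hg hf hsol hRic0 hS hw₀ hnull hgradf hH hκ hσ hlam hc hSC hp hdf hfS (hrot 0).1
      (hκw 0) t
  obtain ⟨τ, hτ, hY₁τ, hYne, hsign⟩ : ∃ τ : ℝ, 0 < τ ∧ Y₁ τ = 0 ∧ Y 0 ≠ Y τ ∧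
      ((a < 0 ∧ 0 < 1 / 2 - C / 2 * Real.exp (Y τ)) ∨
        (0 < a ∧ 1 / 2 - C / 2 * Real.exp (Y τ) < 0)) := by
    rcases lt_or_gt_of_ne ha0 with hneg | hpos
    · obtain ⟨τ, hτ, h1, -, h2, h3⟩ := exists_first_zero_deriv_of_profile_neg hCpos hYd hY₁d hnormY
        hY₁0 (by rw [haY]; exact hneg)
      exact ⟨τ, hτ, h1, h2.ne', Or.inl ⟨hneg, h3⟩⟩
    · obtain ⟨τ, hτ, h1, -, h2, h3⟩ := exists_first_zero_deriv_of_profile hCpos hYd hY₁d hnormY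
        hY₁0 (by rw [haY]; exact hpos)
      exact ⟨τ, hτ, h1, h2.ne, Or.inr ⟨hpos, h3⟩⟩
  set b : ℝ := 1 / 2 - C / 2 * Real.exp (Y τ) with hbdef
  have hb0 : b ≠ 0 := by
    rcases hsign with ⟨-, h⟩ | ⟨-, h⟩
    · exact h.ne'
    · exact h.ne
  have hba : |b / a| = 1 → b = -a := by
    intro h1
    rw [abs_div, div_eq_one_iff_eq (abs_ne_zero.2 ha0)] at h1
    rcases hsign with ⟨ha', hb'⟩ | ⟨ha', hb'⟩
    · rw [abs_of_pos hb', abs_of_neg ha'] at h1; exact h1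
    · rw [abs_of_neg hb', abs_of_pos ha'] at h1; linarith
  -- the point `q = γ_{w s}(τ)` and its independence of `s`: Jacobi fields of the family
  have hJac := fun s ↦ jacobi_along_leaf g hg hf hsol hRic0 hS hw₀ hnull hgradf hH hκ hσ hlam hc hSC
    hp hdf (e := w s) (n₀ := w' s) (ν₀ := ν₀) (hrot s).1 (hrot s).2.1 hνν (hrot s).2.2.1
    (hrot s).2.2.2.1 (hrot s).2.2.2.2 hν ha ha0 (T := τ + 1) (by linarith)
  have hτI : τ ∈ Ioo (-(τ + 1)) (τ + 1) := ⟨by linarith, by linarith⟩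
  have hvelE : ∀ s, velocity (𝓡 3) (X τ) s = 0 := by
    intro s
    obtain ⟨n, -, hJn⟩ := hJac s
    rw [hJeq τ s, (hJn τ hτI).1, hY₁s s τ, hY₁τ, zero_div, zero_smul]
  have hEd : ∀ s, MDifferentiableAt 𝓘(ℝ, ℝ) (𝓡 3) (X τ) s := fun s ↦
    ((hXs.comp (contMDiff_const.prodMk contMDiff_id)) s).mdifferentiableAt (by simp)
  set q : M := X τ 0 with hqdef
  have hq : ∀ s, X τ s = q := fun s ↦ eq_of_velocity_eq_zero hEd hvelE s 0
  -- the arrival direction `Θ(s) ∈ T_q M` and its covariant derivative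
  set Θ : Π s : ℝ, TangentSpace (𝓡 3) (X τ s) := fun s ↦ velocity (𝓡 3) (fun t ↦ X t s) τ with hΘ
  have htors : g.leviCivita.torsion = 0 := hLC.1
  have hDΘ : ∀ s, covariantDerivAlong g.leviCivita (X τ) Θ s =
      covariantDerivAlong g.leviCivita (fun t ↦ X t s)
        (fun t ↦ velocity (𝓡 3) (fun s' : ℝ ↦ maximalGeodesic g.leviCivita p (w s + s' • w' s) t) 0)
        τ := by
    intro s
    have hsym := covariantDerivAlong_velocity_comm g.leviCivita htors
      ((hXs (τ, s)).of_le (WithTop.coe_le_coe.mpr le_top) : ContMDiffAt _ _ 2 (uncurry X) (τ, s))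
    rw [← hsym]
    exact covariantDerivAlong_congr_field g.leviCivita (Eventually.of_forall fun t ↦ hJeq t s)
  have hDΘnorm : ∀ s, g.val (X τ s) (covariantDerivAlong g.leviCivita (X τ) Θ s)
      (covariantDerivAlong g.leviCivita (X τ) Θ s) = (b / a) ^ 2 := by
    intro s
    obtain ⟨n, hn1, hJn⟩ := hJac s
    rw [hDΘ s, (hJn τ hτI).2, hYs s τ]
    simp only [map_smul, FunLike.coe_smul, Pi.smul_apply, smul_eq_mul]
    rw [(hn1 τ hτI).1, ← hbdef]
    ring
  -- `Θ(s)` is a unit leaf vector at `q`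
  have hΘunit : ∀ s, g.val (X τ s) (Θ s) (Θ s) = 1 := fun s ↦ by
    simp only [hΘ]
    rw [g.val_velocity_eq_of_isGeodesicOn_of_isCompatible hLC.2 isOpen_univ Set.ordConnected_univ
      (hXgeo s) (mem_univ τ) (mem_univ 0), hXv s, hX0 s]
    exact (hrot s).1
  have hΘleaf : ∀ s, κ (X τ s) (Θ s) = 0 := fun s ↦ by
    simp only [hΘ]
    rw [kappa_velocity_eq g hg hf hsol hRic0 hS hw₀ hnull hκ (hXgeo s) τ, hXv s, hX0 s]
    exact hκw s
  -- read everything in the chart at `q`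
  obtain ⟨hGm, hGpos, -, -, hSpos, O, hOo, hu₀O, hOT, v, hvs, hpar, hunit, hnullO, hRicO, -⟩ :=
    exists_chart_data g hg hf hsol hRic0 hS hw₀ hnull q
  set φ := extChartAt (𝓡 3) q with hφ
  set G := chartRep (𝓡 3) (fun _ ↦ g) q 0 with hGdef
  set z₀ := φ q with hz₀
  have hz₀T : z₀ ∈ φ.target := mem_extChartAt_target q
  have hsy := hGm.symm z₀ hz₀T
  have hsrc : ∀ s, X τ s ∈ φ.source := fun s ↦ by rw [hq s]; exact mem_extChartAt_source q
  have hφX : ∀ s, φ (X τ s) = z₀ := fun s ↦ by rw [hq s]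
  -- the lift of `Θ` is smooth, hence so are its components `Θ̂`
  have hLΘ : ContMDiff 𝓘(ℝ, ℝ) (𝓡 3).tangent ∞
      (fun s ↦ (TotalSpace.mk' (EuclideanSpace ℝ (Fin 3)) (X τ s) (Θ s) :
        TangentBundle (𝓡 3) M)) := by
    have h := (contMDiff_tangentLift_maximalGeodesic_family hc p).comp
      (contMDiff_const.prodMk hws : ContMDiff 𝓘(ℝ, ℝ) (𝓘(ℝ, ℝ).prod 𝓘(ℝ, EuclideanSpace ℝ (Fin 3)))
        ∞ fun s : ℝ ↦ ((τ, w s) : ℝ × EuclideanSpace ℝ (Fin 3)))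
    exact h
  set Θh : ℝ → EuclideanSpace ℝ (Fin 3) := fun s ↦
    mfderiv (𝓡 3) (𝓡 3) φ (X τ s) (Θ s) with hΘh
  have hΘh𝓣 : Θh = fun s ↦ (trivializationAt (EuclideanSpace ℝ (Fin 3)) (TangentSpace (𝓡 3)) q
      ⟨X τ s, Θ s⟩).2 := funext fun s ↦ (trivializationAt_snd_eq_mfderiv q (hsrc s) (Θ s)).symm
  have hΘhs : ContMDiff 𝓘(ℝ, ℝ) 𝓘(ℝ, EuclideanSpace ℝ (Fin 3)) ∞ Θh := by
    intro s
    have h := Bundle.contMDiffAt_totalSpace.1 (hLΘ s)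
    have h2 := h.2
    change ContMDiffAt 𝓘(ℝ, ℝ) 𝓘(ℝ, EuclideanSpace ℝ (Fin 3)) ∞ (fun s' ↦
      (trivializationAt (EuclideanSpace ℝ (Fin 3)) (TangentSpace (𝓡 3)) (X τ s)
        ⟨X τ s', Θ s'⟩).2) s at h2
    rw [hq s] at h2
    rw [hΘh𝓣]
    exact h2
  have hΘhc : ContDiff ℝ ∞ Θh := contMDiff_iff_contDiff.1 hΘhs
  -- Bridge: `dφ(D_s Θ) = Θ̂'`
  have hbridge : ∀ s, mfderiv (𝓡 3) (𝓡 3) φ (X τ s) (covariantDerivAlong g.leviCivita (X τ) Θ s) =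
      deriv Θh s := by
    intro s
    obtain ⟨-, h⟩ := covariantDerivAlong_chart g q (γ := X τ) (W := Θ) (hsrc s)
      ((hLΘ s).mdifferentiableAt (by simp))
    have hU0 : mfderiv (𝓡 3) (𝓡 3) φ (X τ s) (velocity (𝓡 3) (X τ) s) =
        (0 : EuclideanSpace ℝ (Fin 3)) := by
      rw [hvelE s, map_zero]
      rfl
    have h' : mfderiv (𝓡 3) (𝓡 3) φ (X τ s) (covariantDerivAlong g.leviCivita (X τ) Θ s) =
        deriv Θh s + MetricCoord.chrAt G (φ (X τ s))
          (mfderiv (𝓡 3) (𝓡 3) φ (X τ s) (velocity (𝓡 3) (X τ) s)) (Θh s) := h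
    rw [hU0, map_zero, _root_.zero_apply, add_zero] at h'
    exact h'
  -- dictionary at `X τ s`
  have hdic : ∀ s (A B : TangentSpace (𝓡 3) (X τ s)), g.val (X τ s) A B =
      G z₀ (mfderiv (𝓡 3) (𝓡 3) φ (X τ s) A) (mfderiv (𝓡 3) (𝓡 3) φ (X τ s) B) := by
    intro s A B
    rw [← hφX s]
    exact (dictionary_source g q (hsrc s) hf A B).1
  have hGΘ : ∀ s, G z₀ (Θh s) (Θh s) = 1 := fun s ↦ by rw [hΘh, ← hdic]; exact hΘunit s
  have hGΘ' : ∀ s, G z₀ (deriv Θh s) (deriv Θh s) = (b / a) ^ 2 := fun s ↦ by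
    rw [← hbridge, ← hdic]; exact hDΘnorm s
  have hθΘ : ∀ s, G z₀ (v z₀) (Θh s) = 0 := by
    intro s
    have hO : φ (X τ s) ∈ O := by rw [hφX s]; exact hu₀O
    obtain ⟨h1, -⟩ := chart_reading g q hf hGm hGpos hunit hnullO hRicO hSpos (hsrc s) hO (Θ s)
    rw [← hκ, hΘleaf s, hφX s] at h1
    exact pow_eq_zero_iff (n := 2) (by norm_num) |>.1 h1.symm
  have hθΘ' : ∀ s, G z₀ (v z₀) (deriv Θh s) = 0 := by
    intro s
    have hd : HasDerivAt (fun s ↦ G z₀ (v z₀) (Θh s)) (G z₀ (v z₀) (deriv Θh s)) s :=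
      ((G z₀ (v z₀)).hasFDerivAt).comp_hasDerivAt s
        ((hΘhc.differentiable (by simp)).differentiableAt.hasDerivAt)
    have h0' : HasDerivAt (fun s ↦ G z₀ (v z₀) (Θh s)) 0 s := by
      have : (fun s ↦ G z₀ (v z₀) (Θh s)) = fun _ ↦ 0 := funext hθΘ
      rw [this]; exact hasDerivAt_const s 0
    exact hd.unique h0'
  -- the `G`-orthonormal basis `(ee₁, ee₂, v)` of the leaf plane + null line at `q`
  obtain ⟨n0, hn0prop, -⟩ := hJac 0
  obtain ⟨hn0unit, hn0perp, hn0leaf⟩ := hn0prop τ hτI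
  set ee₁ : EuclideanSpace ℝ (Fin 3) := Θh 0 with hee₁
  set ee₂ : EuclideanSpace ℝ (Fin 3) := mfderiv (𝓡 3) (𝓡 3) φ (X τ 0) (n0 τ) with hee₂
  have g11 : G z₀ ee₁ ee₁ = 1 := hGΘ 0
  have g22 : G z₀ ee₂ ee₂ = 1 := by rw [hee₂, ← hdic]; exact hn0unit
  have g12 : G z₀ ee₁ ee₂ = 0 := by rw [hee₁, hΘh, hee₂, ← hdic]; exact hn0perp
  have gv1 : G z₀ (v z₀) ee₁ = 0 := hθΘ 0
  have gv2 : G z₀ (v z₀) ee₂ = 0 := by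
    have hO : φ (X τ 0) ∈ O := by rw [hφX 0]; exact hu₀O
    obtain ⟨h1, -⟩ := chart_reading g q hf hGm hGpos hunit hnullO hRicO hSpos (hsrc 0) hO (n0 τ)
    rw [← hκ, hn0leaf, hφX 0] at h1
    exact pow_eq_zero_iff (n := 2) (by norm_num) |>.1 h1.symm
  have gvv : G z₀ (v z₀) (v z₀) = 1 := hunit z₀ hu₀O
  have hon : ∀ i j : Fin 3, G z₀ (![ee₁, ee₂, v z₀] i) (![ee₁, ee₂, v z₀] j) =
      if i = j then 1 else 0 := by
    intro i j
    fin_cases i <;> fin_cases j <;>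
      simp [g11, g22, g12, gv1, gv2, gvv, hsy ee₂ ee₁, hsy ee₁ (v z₀), hsy ee₂ (v z₀)]
  have hcard3 : Fintype.card (Fin 3) = finrank ℝ (EuclideanSpace ℝ (Fin 3)) := by simp
  have hexpand : ∀ Xv : EuclideanSpace ℝ (Fin 3), G z₀ (v z₀) Xv = 0 →
      Xv = G z₀ Xv ee₁ • ee₁ + G z₀ Xv ee₂ • ee₂ := by
    intro Xv hXv
    have h := eq_sum_bilin_smul_of_orthonormal (V := EuclideanSpace ℝ (Fin 3)) (G z₀) hon hcard3 Xv
    rw [Fin.sum_univ_three] at h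
    have h0 : (![ee₁, ee₂, v z₀] : Fin 3 → EuclideanSpace ℝ (Fin 3)) 0 = ee₁ := rfl
    have h1 : (![ee₁, ee₂, v z₀] : Fin 3 → EuclideanSpace ℝ (Fin 3)) 1 = ee₂ := rfl
    have h2 : (![ee₁, ee₂, v z₀] : Fin 3 → EuclideanSpace ℝ (Fin 3)) 2 = v z₀ := rfl
    rw [h0, h1, h2, hsy Xv (v z₀), hXv, zero_smul, add_zero] at h
    exact h
  have hsq : ∀ Xv : EuclideanSpace ℝ (Fin 3), G z₀ (v z₀) Xv = 0 →
      G z₀ Xv Xv = (G z₀ Xv ee₁) ^ 2 + (G z₀ Xv ee₂) ^ 2 := by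
    intro Xv hXv
    have h := hexpand Xv hXv
    set c₁ := G z₀ Xv ee₁
    set c₂ := G z₀ Xv ee₂
    conv_lhs => rw [h]
    simp only [map_add, map_smul, _root_.add_apply, FunLike.coe_smul, Pi.smul_apply, smul_eq_mul,
      g11, g22, g12, hsy ee₂ ee₁]
    ring
  -- the planar curve `(α, β)` and the rotation number
  set α : ℝ → ℝ := fun s ↦ G z₀ (Θh s) ee₁ with hα
  set β : ℝ → ℝ := fun s ↦ G z₀ (Θh s) ee₂ with hβ
  have hL : ∀ (c : EuclideanSpace ℝ (Fin 3)) (s : ℝ),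
      HasDerivAt (fun s ↦ G z₀ (Θh s) c) (G z₀ (deriv Θh s) c) s := by
    intro c s
    have hΘd : HasDerivAt Θh (deriv Θh s) s :=
      (hΘhc.differentiable (by simp)).differentiableAt.hasDerivAt
    exact ((G z₀).flip c).hasFDerivAt.comp_hasDerivAt s hΘd
  have hαd : ∀ s, HasDerivAt α (G z₀ (deriv Θh s) ee₁) s := fun s ↦ hL ee₁ s
  have hβd : ∀ s, HasDerivAt β (G z₀ (deriv Θh s) ee₂) s := fun s ↦ hL ee₂ s
  have hΘh' : Continuous (deriv Θh) := hΘhc.continuous_deriv (by simp)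
  have hα₁c : Continuous fun s ↦ G z₀ (deriv Θh s) ee₁ := ((G z₀).flip ee₁).continuous.comp hΘh'
  have hβ₁c : Continuous fun s ↦ G z₀ (deriv Θh s) ee₂ := ((G z₀).flip ee₂).continuous.comp hΘh'
  have hunit' : ∀ s, α s ^ 2 + β s ^ 2 = 1 := fun s ↦ by
    rw [← hsq (Θh s) (hθΘ s)]; exact hGΘ s
  have hcpos : 0 < |b / a| := abs_pos.2 (div_ne_zero hb0 ha0)
  have hspeed : ∀ s, (G z₀ (deriv Θh s) ee₁) ^ 2 + (G z₀ (deriv Θh s) ee₂) ^ 2 = |b / a| ^ 2 :=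
    fun s ↦ by rw [← hsq (deriv Θh s) (hθΘ' s), sq_abs]; exact hGΘ' s
  -- periodicity
  have hw2π : w (2 * Real.pi) = w 0 := by
    simp [hw, Real.cos_two_pi, Real.sin_two_pi]
  have hX2π : (fun t ↦ X t (2 * Real.pi)) = fun t ↦ X t 0 := by
    funext t; simp only [hX]; rw [hw2π]
  have hΘh2π : Θh (2 * Real.pi) = Θh 0 := by
    simp only [hΘh, hΘ]
    rw [hq (2 * Real.pi), hq 0, hX2π]
  have hper : α (2 * Real.pi) = α 0 ∧ β (2 * Real.pi) = β 0 := by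
    simp only [hα, hβ]; rw [hΘh2π]; exact ⟨rfl, rfl⟩
  -- injectivity modulo `2π`
  have hinj : ∀ s ∈ Ioo 0 (2 * Real.pi), (α s, β s) ≠ (α 0, β 0) := by
    intro s hs heq
    simp only [hα, hβ, Prod.mk.injEq] at heq
    -- `Θ̂ s = Θ̂ 0`
    have hΘhs0 : Θh s = Θh 0 := by
      rw [hexpand (Θh s) (hθΘ s), hexpand (Θh 0) (hθΘ 0), heq.1, heq.2]
    -- `Θ s = Θ 0` in `T_q M`
    have hΘs0 : (Θ s : EuclideanSpace ℝ (Fin 3)) = Θ 0 := by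
      have h1 : mfderiv (𝓡 3) (𝓡 3) φ (X τ s) (Θ s) = mfderiv (𝓡 3) (𝓡 3) φ (X τ 0) (Θ 0) := hΘhs0
      rw [hq s, hq 0] at h1
      exact (isInvertible_mfderiv_extChartAt (I := 𝓡 3) (mem_extChartAt_source q)).injective h1
    -- the two geodesics coincide, hence `w s = w 0`
    have heqγ : EqOn (fun t ↦ X t s) (fun t ↦ X t 0) univ :=
      eqOn_of_isGeodesicOn g isOpen_univ Set.ordConnected_univ (hXgeo s) (hXgeo 0) (mem_univ τ)
        (by show X τ s = X τ 0; rw [hq s, hq 0]) hΘs0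
    have hfun : (fun t ↦ X t s) = fun t ↦ X t 0 := funext fun t ↦ heqγ (mem_univ t)
    have hws0 : w s = w 0 := by
      have h := congrArg (fun γ : ℝ → M ↦ (velocity (𝓡 3) γ 0 : EuclideanSpace ℝ (Fin 3))) hfun
      simp only at h
      rwa [hXv s, hXv 0] at h
    -- `cos s = 1`, impossible on `(0, 2π)`
    have hcos : Real.cos s = 1 := by
      have h1 : g.val p (w s) e = Real.cos s := by
        simp only [hw, map_add, map_smul, _root_.add_apply, FunLike.coe_smul, Pi.smul_apply,
          smul_eq_mul, hee]
        rw [hsymm n₀ e, hen]; ring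
      have h2 : g.val p (w 0) e = 1 := by
        simp only [hw, Real.cos_zero, Real.sin_zero, one_smul, zero_smul, add_zero]; exact hee
      rw [← h1, hws0, h2]
    obtain ⟨m, hm⟩ := (Real.cos_eq_one_iff s).1 hcos
    have h1 : (0 : ℝ) < m := by
      have : (0 : ℝ) < (m : ℝ) * (2 * Real.pi) := by rw [hm]; exact hs.1
      exact pos_of_mul_pos_left this (by positivity)
    have h2 : (m : ℝ) < 1 := by
      have : (m : ℝ) * (2 * Real.pi) < 1 * (2 * Real.pi) := by rw [hm, one_mul]; exact hs.2
      exact lt_of_mul_lt_mul_right this (by positivity)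
    have h3 : (0 : ℤ) < m := by exact_mod_cast h1
    have h4 : m < (1 : ℤ) := by exact_mod_cast h2
    omega
  -- the rotation number is one: `|b/a| = 1`
  have hone := rotation_number_eq_one hcpos hαd hβd hα₁c hβ₁c hunit' hspeed hper hinj
  have hbma : b = -a := hba hone
  -- the contradiction: `f = S = C e^{f}` at `p` and `q`, `f p + f q = 2`, `f p ≠ f q`
  have hHq : H q = 0 := by
    simp only [hqdef, hX]
    exact H_comp_eq_zero_of_critical g hg hf hsol hRic0 hS hw₀ hnull hgradf hH hκ hσ hc hp hdf
      (hκw 0) τ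
  have hfq : f q = Y τ := hYs 0 τ
  have hSq : g.scalarCurvature q = C * Real.exp (Y τ) := by rw [hSC q, hHq, sub_zero, hfq]
  have hfSq : f q = g.scalarCurvature q := by
    have h := hnormY τ
    rw [hY₁τ] at h
    rw [hSq, hfq]
    nlinarith [h]
  have hY0 : Y 0 = f p := by simp only [hY]; rw [hX0 0]
  have hfp' : f p = C * Real.exp (f p) := by
    have h := hSC p; rw [hp, sub_zero] at h; rw [← h]; exact hfS
  have hfq' : f q = C * Real.exp (f q) := by
    calc f q = g.scalarCurvature q := hfSq
      _ = C * Real.exp (Y τ) := hSq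
      _ = C * Real.exp (f q) := by rw [hfq]
  have hsum : f p + f q = 2 := by
    have h1 : g.scalarCurvature p = 1 - 2 * a := by rw [ha]; ring
    have h2 : g.scalarCurvature q = 1 - 2 * b := by rw [hSq, hbdef]; ring
    rw [hfS, hfSq, h1, h2, hbma]; ring
  have hpq := eq_of_eq_mul_exp_of_add_eq_two hfp' hfq' hsum
  exact hYne (by rw [hY0, ← hfq, hpq])

/-! ### `S ≡ 1` and `f = 1 + h` -/

/-- **A complete normalised degenerate three-dimensional shrinker has `S ≡ 1` and `f = 1 + h`.**
`S` attains its infimum and supremum at critical points of `f` on `Σ₀`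
(`exists_critical_min_max`), where `S = 1` (`scalarCurvature_eq_one_of_critical`); and
`S = C e^{f − h}` with `1 = S = f = C e^{f}` at such a point gives `C = e^{−1}`, `f − h = 1`.
[cite: MunteanuWang2016, Thm. 1.2] [cite: Hamilton1988, §10] -/
theorem scalarCurvature_eq_one (hlam : lam = 1 / 2)
    (hnorm : ∀ x : M, g.scalarCurvature x + g.gradSq f x = f x)
    (hcpl : ∀ (x : M) (r : ℝ≥0), IsCompact {y : M | g.edist hg x y ≤ r}) (x : M) :
    g.scalarCurvature x = 1 ∧ f x = 1 + H x := by
  haveI := contMDiffCovariantDerivative_leviCivita_one g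
  have hc : IsGeodesicallyComplete g.leviCivita :=
    isGeodesicallyComplete_of_isCompact_closedBall hg hcpl
  obtain ⟨C, hC, hSC, pm, pM, ⟨hpm, hdm, -, hfm, hmin⟩, ⟨hpM, hdM, -, hfM, hmax⟩⟩ :=
    exists_critical_min_max g hg hf hsol hRic0 hS hw₀ hnull hgradf hH hκ hσ hlam hnorm hcpl
  have h1 := scalarCurvature_eq_one_of_critical g hg hf hsol hRic0 hS hw₀ hnull hgradf hH hκ hσ hlam
    hc hSC hpm hdm hfm
  have h2 := scalarCurvature_eq_one_of_critical g hg hf hsol hRic0 hS hw₀ hnull hgradf hH hκ hσ hlam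
    hc hSC hpM hdM hfM
  have hSx : g.scalarCurvature x = 1 := le_antisymm (h2 ▸ hmax x) (h1 ▸ hmin x)
  refine ⟨hSx, ?_⟩
  -- `C = e^{-1}` from the point `pm`
  have hCe : C * Real.exp 1 = 1 := by
    have h := hSC pm
    rw [h1, hpm, sub_zero, hfm, h1] at h
    exact h.symm
  have h := hSC x
  rw [hSx] at h
  -- `1 = C e^{f x − H x}` and `1 = C e^{1}` give `f x − H x = 1`
  have hexp : Real.exp (f x - H x) = Real.exp 1 := by
    have hC0 : C ≠ 0 := hC.ne'
    have e1 : Real.exp (f x - H x) = 1 / C := by field_simp; linarith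
    have e2 : Real.exp 1 = 1 / C := by field_simp; linarith
    rw [e1, e2]
  have := Real.exp_injective hexp
  linarith

end Along


/-! ### Packaging in the vocabulary of `threeShrinkerClassification_modelData` -/

/-- **The degenerate case of the classification, scalar part**: a complete connected normalised
three-dimensional gradient shrinking Ricci soliton (`Ric + Hess f = ½ g`, `S + |∇f|² = f`) with
`Ric ≥ 0`, `S > 0` and a null vector of `Ric` at some point has `S ≡ 1` and
`f = 1 + |∇f|² − 2 Ric(∇f, ∇f)` (the cylinder `S² × ℝ`: `S = 1`, `f = 1 + t²/4`).
[cite: MunteanuWang2016, Thm. 1.2 (p. 3)] [cite: Hamilton1988, §10] -/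
theorem scalarCurvature_eq_one_of_degenerate [T2Space M] [ConnectedSpace M] (hg : g.IsRiemannian)
    {f : M → ℝ} (hf : ContMDiff (𝓡 3) 𝓘(ℝ, ℝ) ∞ f)
    (hsol : ∀ (x : M) (X Y : TangentSpace (𝓡 3) x),
      g.ricci x X Y + g.hessian f x X Y = (1 / 2 : ℝ) * g.val x X Y)
    (hnorm : ∀ x : M, g.scalarCurvature x + g.gradSq f x = f x)
    (hcpl : ∀ (x : M) (r : ℝ≥0), IsCompact {y : M | g.edist hg x y ≤ r})
    (hRic0 : ∀ (x : M) (w : TangentSpace (𝓡 3) x), 0 ≤ g.ricci x w w)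
    (hS : ∀ x, 0 < g.scalarCurvature x) {p : M} {w₀ : TangentSpace (𝓡 3) p} (hw₀ : w₀ ≠ 0)
    (hnull : g.ricci p w₀ w₀ = 0) (x : M) :
    g.scalarCurvature x = 1 ∧
      f x = 1 + (g.gradSq f x - 2 / g.scalarCurvature x *
        g.ricci x (g.sharp x (mvfderiv (𝓡 3) f x : TangentSpace (𝓡 3) x →ₗ[ℝ] ℝ))
          (g.sharp x (mvfderiv (𝓡 3) f x : TangentSpace (𝓡 3) x →ₗ[ℝ] ℝ))) :=
  scalarCurvature_eq_one g hg hf hsol hRic0 hS hw₀ hnull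
    (gradf := fun x ↦ g.sharp x (mvfderiv (𝓡 3) f x : TangentSpace (𝓡 3) x →ₗ[ℝ] ℝ))
    (fun _ ↦ rfl)
    (H := fun x ↦ g.gradSq f x - 2 / g.scalarCurvature x *
      g.ricci x (g.sharp x (mvfderiv (𝓡 3) f x : TangentSpace (𝓡 3) x →ₗ[ℝ] ℝ))
        (g.sharp x (mvfderiv (𝓡 3) f x : TangentSpace (𝓡 3) x →ₗ[ℝ] ℝ)))
    (fun _ ↦ rfl)
    (κ := fun x w ↦ g.val x w w - 2 / g.scalarCurvature x * g.ricci x w w) (fun _ _ ↦ rfl)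
    (σ := fun x w ↦ mvfderiv (𝓡 3) f x w - 2 / g.scalarCurvature x *
      g.ricci x (g.sharp x (mvfderiv (𝓡 3) f x : TangentSpace (𝓡 3) x →ₗ[ℝ] ℝ)) w)
    (fun _ _ ↦ rfl) rfl hnorm hcpl x

end DegenerateShrinker

end Literature.Geometry.Riemannian

end
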